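import Mathlib
import Summits.ValiantsHypothesis.ValiantsHypothesis.Theses.ProofCarryingSymmetry
import Summits.ValiantsHypothesis.ValiantsHypothesis.Theses.MonotoneRestoration
import Summits.ValiantsHypothesis.ValiantsHypothesis.Theorems.ProofCarryingSymmetryRestorationQPPolylogWidth
import Literature.Computability.AlgebraicComplexity.DawarWilsenach2025

/-!
# Strategy census s9 (second INDEPENDENT census, family `-s`) — crux `RestorationQP`
  (item stmt-ValiantsHypothesis-10343, route ProofCarryingSymmetry) — kernel-checked part

Companion of `Cruxes/RestorationQP/STRATEGY-CENSUS-s9.md`.  Nothing here is a new statement item;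
the `def`s are census vocabulary (pieces of candidate decompositions) and every theorem is a
composition of tree theorems.  What it certifies:

* `restorationQP_iff_widthLaw_and_widthConverse` — the best typed split found,
  `RestorationQP ↔ WidthLaw ∧ WidthConverse` (W = "every diagonally invariant VP family has polylog
  counting width", D = "polylog counting width + VP ⇒ quasi-polynomial symmetric circuits", the
  Dawar–Pago–Seppelt converse question restricted to VP), with the assembly
  `restorationQP_of_widthLaw_of_widthConverse` PROVED …
* … and why it is NOT a redirect: `valiantsHypothesis_of_widthLaw` — piece W alone decides the
  summit (tree: `valiantsHypothesis_of_widthLawVP`), so W is summit-strength and D carries no load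
  toward `VP ≠ VNP`.
* `valiantsHypothesis_of_not_arithmeticCFI` — the weakest tree-visible sufficient intermediate below
  the crux is `¬ ArithmeticCFI` (chain `RestorationQP ⇒ WidthLaw ⇒ ¬ArithmeticCFI ⇒ VH`, every arrow a
  tree theorem: `widthLawVP_of_restorationQP`, `not_arithmeticCFI_of_widthLawVP`,
  `arithmeticCFI_or_valiantsHypothesis`).
* `orbitRestorationQP_of_restorationQP` — the sibling route's sole load-bearing crux
  `MonotoneRestoration.OrbitRestorationQP` (item stmt-ValiantsHypothesis-18293) is a WEAKER
  intermediate already filed and staffed (matrix symmetry `S_n × S_n` ⊇ diagonal `S_n` on the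
  hypothesis side, orbit size ≤ gate count on the conclusion side): the "weaker intermediate"
  inventory for this crux lands on an existing item, not on a new line.
-/

-- single-problem summit: `Summit.ValiantsHypothesis.ValiantsHypothesis.…` is the namespace by design (D-0017)
set_option linter.dupNamespace false

noncomputable section

open scoped Classical

namespace Summit.ValiantsHypothesis.ValiantsHypothesis.Cruxes.RestorationQP.CensusS9

open Literature.Computability.AlgebraicComplexity
open Literature.ModelTheory.FiniteModelTheory
open Summit.ValiantsHypothesis.ValiantsHypothesis.Theses.ProofCarryingSymmetry (RestorationQP)
open Summit.ValiantsHypothesis.ValiantsHypothesis.Theses.MonotoneRestoration (OrbitRestorationQP)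
open Summit.ValiantsHypothesis.ValiantsHypothesis.Theorems

/-- Families of polynomials on the `n × n` matrix of variables over `ℂ`. -/
abbrev Fam : Type := (n : ℕ) → MvPolynomial (Fin n × Fin n) ℂ

/-- Diagonal `S_n`-invariance (the crux's hypothesis, verbatim). -/
def DiagInvariant (f : Fam) : Prop :=
  ∀ (n : ℕ) (σ : Equiv.Perm (Fin n)),
    MvPolynomial.rename (fun x : Fin n × Fin n => σ • x) (f n) = f n

/-- Polylogarithmic counting width, uniformly in `n` (the conclusion of the tree's width law). -/
def PolylogWidth (f : Fam) : Prop :=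
  ∃ c' : ℕ, ∀ (n : ℕ) (X Y : SimpleGraph (Fin n)),
    CkEquiv ((Nat.log 2 n + c') ^ c') X Y →
      MvPolynomial.eval (Set.indicator {ij : Fin n × Fin n | X.Adj ij.1 ij.2} 1) (f n) =
        MvPolynomial.eval (Set.indicator {ij : Fin n × Fin n | Y.Adj ij.1 ij.2} 1) (f n)

/-- Quasi-polynomial square-symmetric circuits (the crux's conclusion, verbatim). -/
def QPSymmetric (f : Fam) : Prop :=
  ∃ c : ℕ, ∀ n : ℕ, ∃ (G : Type) (_ : Fintype G)
    (C : LabelledArithCircuit ℂ (Fin n × Fin n) Unit G),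
    C.IsSymmetric (Equiv.Perm (Fin n)) ∧ C.eval (C.output ()) = f n ∧
      Fintype.card G ≤ 2 ^ ((Nat.log 2 n + c) ^ c)

/-- Piece **W** — the width law: every diagonally invariant VP family has polylog counting width. -/
def WidthLaw : Prop := ∀ f : Fam, DiagInvariant f → IsVPFamily f → PolylogWidth f

/-- Piece **D** — the Dawar–Pago–Seppelt converse on VP: polylog counting width (+ VP + invariance)
suffices for quasi-polynomial symmetric circuits. [cite: DawarPagoSeppelt2025, §1 p. 5 (converse
question)] -/
def WidthConverse : Prop :=
  ∀ f : Fam, DiagInvariant f → IsVPFamily f → PolylogWidth f → QPSymmetric f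

/-- The assembly of the split `W ∧ D ⇒ crux` (one line). -/
theorem restorationQP_of_widthLaw_of_widthConverse (hW : WidthLaw) (hD : WidthConverse) :
    RestorationQP :=
  fun f hs hv => hD f hs hv (hW f hs hv)

/-- `crux ⇒ W` (tree: `widthLawVP_of_restorationQP`, engine `stub_fooling_of_qpSymmetric`). -/
theorem widthLaw_of_restorationQP (hR : RestorationQP) : WidthLaw :=
  fun f hs hv => widthLawVP_of_restorationQP hR f hs hv

/-- `crux ⇒ D` (drop the width hypothesis). -/
theorem widthConverse_of_restorationQP (hR : RestorationQP) : WidthConverse :=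
  fun f hs hv _ => hR f hs hv

/-- The split is an honest factorisation: `crux ↔ W ∧ D`. -/
theorem restorationQP_iff_widthLaw_and_widthConverse : RestorationQP ↔ WidthLaw ∧ WidthConverse :=
  ⟨fun h => ⟨widthLaw_of_restorationQP h, widthConverse_of_restorationQP h⟩,
    fun h => restorationQP_of_widthLaw_of_widthConverse h.1 h.2⟩

/-- … but NOT a redirect: piece W alone decides the summit (tree: `valiantsHypothesis_of_widthLawVP`,
through `arithmeticCFI_or_valiantsHypothesis` — were `per ∈ VP` the permanent would break the law on
Dawar–Wilsenach's CFI pairs). -/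
theorem valiantsHypothesis_of_widthLaw (hW : WidthLaw) : _root_.ValiantsHypothesis :=
  valiantsHypothesis_of_widthLawVP (fun f hs hv => hW f hs hv)

/-- The weakest tree-visible sufficient intermediate: `¬ ArithmeticCFI ⇒ VH`. -/
theorem valiantsHypothesis_of_not_arithmeticCFI (h : ¬ ArithmeticCFI) : _root_.ValiantsHypothesis :=
  arithmeticCFI_or_valiantsHypothesis.resolve_left h

/-- … and it sits below W: `W ⇒ ¬ ArithmeticCFI` (tree: `not_arithmeticCFI_of_widthLawVP`). -/
theorem not_arithmeticCFI_of_widthLaw (hW : WidthLaw) : ¬ ArithmeticCFI :=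
  not_arithmeticCFI_of_widthLawVP (fun f hs hv => hW f hs hv)

/-- The sibling route's crux `OrbitRestorationQP` (item stmt-ValiantsHypothesis-18293, sole binder of
`MonotoneRestoration.closes`) is implied by this crux: matrix (`S_n × S_n`) invariance gives diagonal
invariance (`τ := σ`), and orbit size is at most the number of gates (`orbitSize_le_size`). -/
theorem orbitRestorationQP_of_restorationQP (hR : RestorationQP) : OrbitRestorationQP := by
  intro f hmat hVP
  have hdiag : ∀ (n : ℕ) (σ : Equiv.Perm (Fin n)),
      MvPolynomial.rename (fun x : Fin n × Fin n => σ • x) (f n) = f n := by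
    intro n σ
    have hfun : (fun x : Fin n × Fin n => σ • x) = fun p : Fin n × Fin n => (σ p.1, σ p.2) := by
      funext p; rfl
    rw [hfun]
    exact hmat n σ σ
  obtain ⟨c, hc⟩ := hR f hdiag hVP
  refine ⟨c, fun n => ?_⟩
  obtain ⟨G, inst, C, hsymm, heval, hcard⟩ := hc n
  refine ⟨G, inst, C, hsymm, heval, ?_⟩
  have h1 : C.orbitSize (Equiv.Perm (Fin n)) ≤ C.size := C.orbitSize_le_size (Equiv.Perm (Fin n))
  have h2 : C.size = Fintype.card G := rfl
  omega

end Summit.ValiantsHypothesis.ValiantsHypothesis.Cruxes.RestorationQP.CensusS9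

end
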